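import Summits.AnomalousDissipation.AnomalousDissipation.Theses.MomentParity

/-!
# Sketch — crux-ideate stmt-AnomalousDissipation-14283 (GalerkinInvariantLoud), round 1, ideator 2

First lemmas of the two idea cards (they must ELABORATE; proofs are not required here):

* card `conley-continuation-loud-saddles`:
  `GalerkinKrylovBogoliubov` (Krylov–Bogoliubov + Liouville at Galerkin level `N`: a window-trapped
  Galerkin trajectory yields a measure with the crux's clause block) and the Galerkin-level output of
  Rybakowski's index continuation, `WindowTrappedTrajectories`; the composition
  `gil_of_trapped : GalerkinKrylovBogoliubov → WindowTrappedTrajectories → GalerkinInvariantLoud`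
  is kernel-checked (pure logic, `∀ᶠ ⇒ ∃ᶠ`).
* card `taylor-cone-homogenisation`:
  `EnergyFloor` (kinematic energy floor from the momentum balance against `P_N f`),
  `LoudnessLeForce` (energy identity `ε(μ) = (f, ū) ≤ |f| √e`), the transfer target
  `TaylorScaleEnsemble` (one homogeneous cone inequality `κ·e(μ) ≤ ε(μ)`), and the two directions
  `TaylorReduction`, `TaylorConverse` as Props.
-/

noncomputable section

open MeasureTheory Filter

namespace Summit.AnomalousDissipation.AnomalousDissipation.Cruxes.GalerkinInvariantLoud.Ideator2

open Literature.Analysis.FunctionSpaces Literature.Analysis.FluidPDE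

local notation "𝕋³" => UnitAddTorus (Fin 3)
local notation "E³" => EuclideanSpace ℝ (Fin 3)
local notation "H³" => Literature.Analysis.FunctionSpaces.Torus.energySpace (Fin 3)

/-- A field carried by the Galerkin level `N` (Fourier support in `0 < |k| ≤ N`; verbatim the
crux's clause). -/
def IsBandLimited (N : ℕ) (v : 𝕋³ → E³) : Prop :=
  ∀ k ∉ (Torus.freqBall N).erase (0 : Fin 3 → ℤ),
    UnitAddTorus.mFourierCoeff (EuclideanSpace.complexify ∘ v) k = 0

/-- An admissible test field at level `N` (verbatim the crux's conjunction). -/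
def IsTestField (N : ℕ) (g : 𝕋³ → E³) : Prop :=
  Torus.IsSmooth g ∧ Torus.IsDivFree g ∧ Torus.HasZeroMean g ∧ IsBandLimited N g

/-- Stationarity against every polynomial cylindrical observable with level-`N` test fields
(verbatim the crux's clause, no degree bound). -/
def IsPolyStationary (ν : ℝ) (f : 𝕋³ → E³) (N : ℕ) (μ : Measure H³) : Prop :=
  ∀ (m : ℕ) (g : Fin m → 𝕋³ → E³) (P : MvPolynomial (Fin m) ℝ), (∀ i, IsTestField N (g i)) →
    Integrable (fun u => Torus.nsGeneratorPairing ν f u (fun x => ∑ i : Fin m,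
      (MvPolynomial.eval (fun j => Torus.pairing u.1 (g j)) (MvPolynomial.pderiv i P)) • g i x)) μ ∧
    ∫ u, Torus.nsGeneratorPairing ν f u (fun x => ∑ i : Fin m,
      (MvPolynomial.eval (fun j => Torus.pairing u.1 (g j)) (MvPolynomial.pderiv i P)) • g i x) ∂μ = 0

/-- The crux's clause block for ONE measure at `(ν, f, N, R, E, ε)`. -/
def LoudBlock (ν : ℝ) (f : 𝕋³ → E³) (N : ℕ) (R E ε : ℝ) (μ : Measure H³) : Prop :=
  IsProbabilityMeasure μ ∧ (∀ᵐ (u : H³) ∂μ, IsBandLimited N (u.1 : 𝕋³ → E³)) ∧ (∀ᵐ u ∂μ, ‖u‖ ≤ R) ∧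
    IsPolyStationary ν f N μ ∧ Torus.ensembleEnergy μ ≤ E ∧ ε ≤ Torus.ensembleDissipation ν μ

/-- Read-back: the crux IS `∃ f ν E ε …, ∀ j ∃ R, ∃ᶠ N, ∃ μ, LoudBlock`. -/
theorem gil_iff :
    Theses.MomentParity.GalerkinInvariantLoud ↔
      ∃ f : 𝕋³ → E³, Torus.IsSmooth f ∧ Torus.IsDivFree f ∧ Torus.HasZeroMean f ∧
        ∃ (ν : ℕ → ℝ) (E ε : ℝ), (∀ j, 0 < ν j) ∧ Tendsto ν atTop (nhds 0) ∧ 0 < ε ∧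
          ∀ j : ℕ, ∃ R : ℝ, ∃ᶠ N in atTop, ∃ μ : Measure H³, LoudBlock (ν j) f N R E ε μ :=
  Iff.rfl

/-! ## Card A — `conley-continuation-loud-saddles` -/

/-- **First lemma (card A): Krylov–Bogoliubov + Liouville at Galerkin level `N`.**
A continuous path `u : ℝ → H` of level-`N` fields solving the tested Galerkin equations with the
steady force `f` (against every level-`N` test field, in time-integrated form through the tree's
`Torus.nsGeneratorPairing`) and staying for `t ≥ 0` in the ball `‖u‖ ≤ R` and in the WINDOW
`‖u‖² ≤ E`, `ν‖∇u‖² ≥ ε` yields a Borel probability measure with the crux's clause block at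
`(ν, f, N, R, E, ε)` (a Cesàro/Banach-limit time average; stationarity against polynomial
cylindrical tests is the time average of `d/dt P((u,g₁),…,(u,gₘ))`; energy and dissipation are
continuous on the finite-dimensional ball, so the pointwise window passes to the means). -/
def GalerkinKrylovBogoliubov : Prop :=
  ∀ (ν : ℝ) (f : 𝕋³ → E³) (N : ℕ) (R E ε : ℝ), 0 < ν →
    Torus.IsSmooth f → Torus.IsDivFree f → Torus.HasZeroMean f →
    ∀ u : ℝ → H³, Continuous u →
      (∀ t, IsBandLimited N ((u t).1 : 𝕋³ → E³)) →
      (∀ a : 𝕋³ → E³, IsTestField N a → ∀ s t : ℝ, s ≤ t →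
        Torus.pairing (u t).1 a - Torus.pairing (u s).1 a =
          ∫ τ in s..t, Torus.nsGeneratorPairing ν f (u τ) a) →
      (∀ t, 0 ≤ t → ‖u t‖ ≤ R ∧ ‖u t‖ ^ 2 ≤ E ∧
        ε ≤ ν * (Torus.eGradNormSq ((u t).1 : 𝕋³ → E³)).toReal) →
      ∃ μ : Measure H³, LoudBlock ν f N R E ε μ

/-- **Transfer target of card A at the Galerkin level** (what Rybakowski's continuation of the
homotopy index delivers from an indexed loud invariant set of `NS_{ν_j}`): for every `j`,
EVENTUALLY in `N`, one level-`N` Galerkin trajectory trapped in the window for all `t ≥ 0`. -/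
def WindowTrappedTrajectories : Prop :=
  ∃ f : 𝕋³ → E³, Torus.IsSmooth f ∧ Torus.IsDivFree f ∧ Torus.HasZeroMean f ∧
    ∃ (ν : ℕ → ℝ) (E ε : ℝ), (∀ j, 0 < ν j) ∧ Tendsto ν atTop (nhds 0) ∧ 0 < ε ∧
      ∀ j : ℕ, ∃ R : ℝ, ∀ᶠ N in atTop, ∃ u : ℝ → H³, Continuous u ∧
        (∀ t, IsBandLimited N ((u t).1 : 𝕋³ → E³)) ∧
        (∀ a : 𝕋³ → E³, IsTestField N a → ∀ s t : ℝ, s ≤ t →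
          Torus.pairing (u t).1 a - Torus.pairing (u s).1 a =
            ∫ τ in s..t, Torus.nsGeneratorPairing (ν j) f (u τ) a) ∧
        (∀ t, 0 ≤ t → ‖u t‖ ≤ R ∧ ‖u t‖ ^ 2 ≤ E ∧
          ε ≤ ν j * (Torus.eGradNormSq ((u t).1 : 𝕋³ → E³)).toReal)

/-- Composition (kernel-checked): K–B + trapped trajectories ⇒ the crux (`∀ᶠ ⇒ ∃ᶠ`). -/
theorem gil_of_trapped (hKB : GalerkinKrylovBogoliubov) (hW : WindowTrappedTrajectories) :
    Theses.MomentParity.GalerkinInvariantLoud := by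
  rw [gil_iff]
  obtain ⟨f, hfs, hfd, hfz, ν, E, ε, hν, hν0, hε, hj⟩ := hW
  refine ⟨f, hfs, hfd, hfz, ν, E, ε, hν, hν0, hε, fun j => ?_⟩
  obtain ⟨R, hR⟩ := hj j
  refine ⟨R, (hR.mono ?_).frequently⟩
  rintro N ⟨u, hu, hband, hgal, hwin⟩
  exact hKB (ν j) f N R E ε (hν j) hfs hfd hfz u hu hband hgal hwin

/-! ## Card B — `taylor-cone-homogenisation` -/

/-- **First lemma (card B, i): the kinematic ENERGY FLOOR.** For a compactly supported level-`N`
probability measure stationary for Galerkin NS at `(ν, f)`, testing the LINEAR observable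
`u ↦ (u, P_N f)` gives the mean momentum balance against the force,
`|P_N f|² = -ν(ū, ΔP_N f) - ∫ (u ⊗ u) : ∇P_N f dμ ≤ ν‖ΔP_N f‖₂ √e + G e`, `G = ‖∇P_N f‖_∞`,
`e = ∫|u|² dμ`: every invariant measure pays energy `e ≥ (|P_N f|² - ν‖ΔP_N f‖√e)/G`
(a Michell-type statics bound: a PSD stress field balancing the load `f` costs trace-mass). -/
def EnergyFloor : Prop :=
  ∀ (ν : ℝ) (f : 𝕋³ → E³) (N : ℕ) (G : ℝ) (μ : Measure H³), 0 < ν →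
    Torus.IsSmooth f → Torus.IsDivFree f → Torus.HasZeroMean f →
    (∀ x v, ‖Torus.fderiv (Torus.fourierTruncate N f) x v‖ ≤ G * ‖v‖) →
    IsProbabilityMeasure μ → (∀ᵐ (u : H³) ∂μ, IsBandLimited N (u.1 : 𝕋³ → E³)) →
    (∃ R : ℝ, ∀ᵐ u ∂μ, ‖u‖ ≤ R) → IsPolyStationary ν f N μ →
      (∫ x, ‖Torus.fourierTruncate N f x‖ ^ 2) ≤
        ν * Real.sqrt (∫ x, ‖Torus.laplacian (Torus.fourierTruncate N f) x‖ ^ 2) *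
            Real.sqrt (Torus.ensembleEnergy μ) + G * Torus.ensembleEnergy μ

/-- **First lemma (card B, ii): energy identity and the force ceiling.** Testing the QUADRATIC
observable `½ Σᵢ (u, gᵢ)²` over a Stokes basis of `P_N H` gives `ν∫‖∇u‖² dμ = ∫ (u, f) dμ`
(the inertial pairing `∫ (u ⊗ u) : ∇u = 0`), whence `ε(μ) ≤ |f|₂ √e` by Cauchy–Schwarz/Jensen. -/
def LoudnessLeForce : Prop :=
  ∀ (ν : ℝ) (f : 𝕋³ → E³) (N : ℕ) (μ : Measure H³), 0 < ν →
    Torus.IsSmooth f → Torus.IsDivFree f → Torus.HasZeroMean f →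
    IsProbabilityMeasure μ → (∀ᵐ (u : H³) ∂μ, IsBandLimited N (u.1 : 𝕋³ → E³)) →
    (∃ R : ℝ, ∀ᵐ u ∂μ, ‖u‖ ≤ R) → IsPolyStationary ν f N μ →
      Torus.ensembleDissipation ν μ = ∫ u, Torus.pairing u.1 f ∂μ ∧
        Torus.ensembleDissipation ν μ ≤ Real.sqrt (∫ x, ‖f x‖ ^ 2) * Real.sqrt (Torus.ensembleEnergy μ)

/-- **Transfer target of card B: `TaylorScaleEnsemble`** — the crux with its two-sided window
`(e ≤ E, ε ≤ ν∫‖∇u‖²)` replaced by ONE homogeneous cone inequality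
`κ · ∫|u|² dμ ≤ ν ∫‖∇u‖² dμ` (mean spectral centroid at or above the Taylor wavenumber
`k_T² = κ/(4π²ν)`), for a non-zero force. -/
def TaylorScaleEnsemble : Prop :=
  ∃ f : 𝕋³ → E³, Torus.IsSmooth f ∧ Torus.IsDivFree f ∧ Torus.HasZeroMean f ∧ f ≠ 0 ∧
    ∃ (ν : ℕ → ℝ) (κ : ℝ), (∀ j, 0 < ν j) ∧ Tendsto ν atTop (nhds 0) ∧ 0 < κ ∧
      ∀ j : ℕ, ∃ R : ℝ, ∃ᶠ N in atTop, ∃ μ : Measure H³, IsProbabilityMeasure μ ∧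
        (∀ᵐ (u : H³) ∂μ, IsBandLimited N (u.1 : 𝕋³ → E³)) ∧ (∀ᵐ u ∂μ, ‖u‖ ≤ R) ∧
        IsPolyStationary (ν j) f N μ ∧
        κ * Torus.ensembleEnergy μ ≤ Torus.ensembleDissipation (ν j) μ

/-- Card B, direction `C⁺ ⇒ crux`: with `E := |f|₂²/κ²` (force ceiling) and
`ε := κ · (energy floor)/2` (energy floor, `ν_j` small), a Taylor-scale ensemble IS loud and bounded. -/
def TaylorReduction : Prop :=
  EnergyFloor → LoudnessLeForce → TaylorScaleEnsemble → Theses.MomentParity.GalerkinInvariantLoud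

/-- Card B, direction `crux ⇒ C⁺` (`κ := ε/E`; `f ≠ 0` because `ε > 0` forces `(f, ū) > 0`). -/
def TaylorConverse : Prop :=
  Theses.MomentParity.GalerkinInvariantLoud → TaylorScaleEnsemble

end Summit.AnomalousDissipation.AnomalousDissipation.Cruxes.GalerkinInvariantLoud.Ideator2

end
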